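import Mathlib
import Literature.NumberTheory.LFunctions.Zhang2022.TypedSection15ASubsteps
import Literature.NumberTheory.LFunctions.Zhang2022.Section15U008Alpha
import Literature.NumberTheory.LFunctions.Zhang2022.TypedSection15BSubsteps
import HarnessLib

/-!
# Zhang (2022) §15: one-line bridges between the WP15 typer nodes and the tree (theorems only)

Topic `Literature/NumberTheory/LFunctions/Zhang2022` (Landau–Siegel audit tree; verdict-neutral).
Y. Zhang, *Discrete mean estimates and the Landau–Siegel zero*, arXiv:2211.02515v1 (2022)
[Zhang2022LandauSiegel] — an unrefereed manuscript under adjudication; nothing here asserts or denies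
its Theorems 1–2. Lane ZHANG-L, WP15 (typer bookkeeping): (1) the RT15-int-1 node `Step15_u008alpha`
(TypedSection15ASubsteps, append p478154) IS the tree theorem `Section15U008Alpha.step15_u008alpha_holds`
(zl-w15-p6) — its `M₁` abbreviation `mainU008alpha` unfolds to that theorem's inline main term — so
the node is DISCHARGED by name here (`step15_u008alpha_node_holds`); (2) the support reading `Eq15_15S`
is implied by the typed (15.15) `Eq15_15` (`eq15_15S_of_eq15_15`). (The u055 hierarchy
`Step15_u055R → Step15_u055Rel → Step15_u055RelS` is already in the tree: `step15_u055Rel_of_R`,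
`Section15U056RateRelS.step15_u055RelS_of_Rel`.) Theorems only; no claims. WHAT THIS IS NOT: a
proof of u055 or (15.15) in any reading, nor any claim about Theorems 1–2 / Landau–Siegel zeros.

## References
* Y. Zhang, arXiv:2211.02515v1 (2022), §15 pp. 80, 85, 87. [cite: Zhang2022LandauSiegel, §15 pp. 80–88]
-/

noncomputable section

open Complex Real ComplexConjugate
open Literature.NumberTheory.LFunctions.Zhang2022.Skeleton

namespace Literature.NumberTheory.LFunctions.Zhang2022.Typed.Section15A

/-- **`Step15_u008alpha` DISCHARGED** — it is `Section15U008Alpha.step15_u008alpha_holds` (zl-w15-p6)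
with the main term named `mainU008alpha`. [cite: Zhang2022LandauSiegel, §15 p. 80] -/
theorem step15_u008alpha_node_holds (c' : ℝ) : Step15_u008alpha c' := step15_u008alpha_holds c'

end Literature.NumberTheory.LFunctions.Zhang2022.Typed.Section15A


namespace Literature.NumberTheory.LFunctions.Zhang2022.Typed.Section15B

/-- The typed (15.15) implies its support reading (drop the extra hypothesis `T < P₄/d`).
[cite: Zhang2022LandauSiegel, §15 (15.15) p. 85] -/
theorem eq15_15S_of_eq15_15 (c' : ℝ) (h : Eq15_15 c') : Eq15_15S c' := by
  obtain ⟨c, hc, C, D₀, hF⟩ := h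
  exact ⟨c, hc, C, D₀, fun D _ χ hD hq hp hA d l hd hl hdl _ hcop =>
    hF D χ hD hq hp hA d l hd hl hdl hcop⟩

end Literature.NumberTheory.LFunctions.Zhang2022.Typed.Section15B
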